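import Summits.ResolutionOfSingularities.ResolutionOfSingularities.Theses.PAlteration
import Summits.ResolutionOfSingularities.ResolutionOfSingularities.Theorems.PAlterationPialtStubSplitData
import Summits.ResolutionOfSingularities.ResolutionOfSingularities.Theorems.PAlterationPialtStubImageNeUniv
import Summits.ResolutionOfSingularities.ResolutionOfSingularities.Theorems.PAlterationPialtStubFrobIndetOfPialt
import Summits.ResolutionOfSingularities.ResolutionOfSingularities.Theorems.PAlterationPialtStubPiRegModelOfBirational
import Summits.ResolutionOfSingularities.ResolutionOfSingularities.Theorems.PAlterationPialtStubHypersurfaceModel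
import Summits.ResolutionOfSingularities.ResolutionOfSingularities.Theorems.PAlterationPialtNormalProper
import Summits.ResolutionOfSingularities.ResolutionOfSingularities.Theorems.PAlterationPalterationThesisPialtOfPerfect
import Summits.ResolutionOfSingularities.ResolutionOfSingularities.Theorems.Pialt.Negative.LoadBearing
import Literature.AlgebraicGeometry.Motives.VarietiesProperProofs
import Literature.AlgebraicGeometry.Resolution.ProjectiveSpaceRegular
import HarnessLib

/-!
# Skeleton `indeterminacy-split` (ALTERNATIVE line, crux-strategist s1) for crux
# stmt-ResolutionOfSingularities-0555 `Pialt`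

Registered as an ALTERNATIVE to the live line `Lines/SketchIdeator2.lean` (Card A,
radicially-regular-endgame, lead c1) — it does not replace it. Source idea: Card B
`Cruxes/Pialt/Ideas/indeterminacy-split.md` (ideator 2), whose exactness pieces lead a2 landed as
a "second structure" (`Theorems/PAlterationPialtStub{FrobIndetOfPialt,SplitData,ImageNeUniv}.lean`).
Census: `Cruxes/Pialt/STRATEGY-CENSUS.md`. Card: `Lines/IndeterminacySplit.md`.

`Pialt` = Abramovich–Oort in characteristic `p`: every integral separated `X` of finite type over
a field of characteristic `p` has a purely inseparable REGULAR alteration. WLOG `k` perfect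
(`stub_pialtOfPerfect`, landed) and `X` proper (`pialtConclusion_of_forall_normal_proper`, landed).

THE CUT (birational seam; exact — `Pialt ⇔ FrobIndet ∧ PiRegModel`, converses landed):
* `FrobIndet` — purely inseparable ELIMINATION OF INDETERMINACY of rational maps out of REGULAR
  proper varieties (= the crux for graph closures / blow-ups of regular varieties; embedded form,
  where p.i. covers add the root-rescaling move `Y[y^{1/p}]`);
* `PiRegModel` — every proper integral variety has a REGULAR proper purely inseparable MODEL (no
  morphism to `X`: model freedom).
Why this dodges the STUCK state of the live line: Card A's open stubs are, modulo the published
`Temkin2013`, `RRLU1 ∧ TwoModelPatching` = the SUMMIT (`resolutionInChar_iff_rrLU1_and_twoModelPatching`);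
here neither piece is known to imply resolution (strategist probes: `FrobIndet → Pialt`,
`PiRegModel → Pialt`, `· → ResolutionOfSingularities`, `· by exact?` all FAIL), so the line
stays strictly inside the crux.

REGISTERED STUBS (4; the composition `Pialt_of` consumes all four). UPDATE (line lead c2,
2026-08-17): `stub_hypersurfaceModel` LANDED (p139710, `Theorems/PAlterationPialtStubHypersurfaceModel.lean`)
and `stub_piRegModel_of_birational` LANDED (p138968, `Theorems/PAlterationPialtStubPiRegModelOfBirational.lean`),
both imported below; the OPEN stubs are exactly `stub_frobIndet` and `stub_hypersurfacePialt` (2 sorries).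
Original list:
* `stub_frobIndet` (OPEN from dim 4; dim ≤ 3 ⇐ CossartPiltant2019 on the graph closure) — the
  hardest stub;
* `stub_hypersurfacePialt` (OPEN from dim 4) — the crux for integral HYPERSURFACES of `ℙⁿ⁺¹_k`
  (embedded, codimension one in a regular ambient space): the road to `PiRegModel` taken here;
* `stub_hypersurfaceModel` (KNOWN, L-sized formalisation) — every integral variety over a perfect
  field is birational to an integral hypersurface of some `ℙⁿ⁺¹_k` (separating transcendence basis
  + primitive element + projective closure; e.g. Hartshorne I.4.9);
* `stub_piRegModel_of_birational` (M-sized glue) — the crux conclusion at a proper `H` birational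
  to the proper `X` yields a regular purely inseparable model of `X`.
`PiRegModelOver k` := the last three; `FrobIndetOver k` := the first; then the strategist's glue
(evidence `PAlterationPialtSplit.lean` on the item, reproduced below sorry-free):
proper case by `stub_image_ne_univ_of_isClosed` + `stub_pialtShape_of_split_data`, general `X` by
`pialtConclusion_of_forall_normal_proper`, every field by `stub_pialtOfPerfect`.

Disproof used (`Cruxes/Pialt/Disproof.lean` v1.1 + `Theorems/Pialt/Negative/*`): every stub keeps
`IsIntegral` (`pialt_false_without_isIntegral/irreducible`), finite type / properness
(`pialt_false_without_locallyOfFiniteType`), the `∃ V' dense` relaxation (`not_pialtFinite`: no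
stub asks finiteness over all of `Y`/`H`), and surjectivity onto a NON-EMPTY open in the model
stubs (excludes the junk witness of `pialt_without_surjective_trivial`); no stub is the birational
strengthening (`pialt_birational_iff_resolutionOfSingularities` = summit).
-/

set_option linter.dupNamespace false

noncomputable section

open CategoryTheory CategoryTheory.Limits AlgebraicGeometry TopologicalSpace
open Literature.AlgebraicGeometry.Resolution
open Literature.AlgebraicGeometry.Motives (projectiveSpace isProper_projectiveSpace)
open Summit.ResolutionOfSingularities.ResolutionOfSingularities.Theses.PAlteration (Pialt)

namespace Summit.ResolutionOfSingularities.ResolutionOfSingularities.Theorems.Pialt.IndeterminacySplit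

/-! ## Stubs -/

/-- STUB (OPEN from dimension 4; the HARDEST stub): **`FrobIndet` — purely inseparable
elimination of indeterminacy on regular proper varieties over a perfect field.** For `Y` regular
proper integral, `X₁` proper integral and a `k`-morphism `φ : V → X₁` on a non-empty open
`V ⊆ Y`, there are a proper surjective `g : Y' → Y` with `Y'` integral regular, finite and
universally injective over a dense open of `Y`, and a `k`-morphism `ψ : Y' → X₁` with
`ψ = φ ∘ g` on `g⁻¹(V)`. Special case of the crux (graph closure; converse direction landed:
`stub_frobIndet_of_pialtOver`). First open instance: principalize a coherent ideal on a regular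
4-fold up to purely inseparable regular alteration (e.g. the ideal of the `k[V₂⊕V₂]^{ℤ/p}`
specimen on `𝔸⁴`, card (3)); mechanism: root-rescaling along regular parameters (card (4)). -/
theorem stub_frobIndet (p : ℕ) (hp : p.Prime) (k : Type) [Field k] [CharP k p] [PerfectField k]
    (Y X₁ : Scheme.{0}) (fY : Y ⟶ Spec (.of k)) (f₁ : X₁ ⟶ Spec (.of k)) [IsProper fY]
    [IsProper f₁] [IsIntegral Y] (hY : Scheme.IsRegular Y) [IsIntegral X₁] (V : Y.Opens)
    (φ : (V : Scheme.{0}) ⟶ X₁) (hV : (V : Set Y).Nonempty) (hφ : V.ι ≫ fY = φ ≫ f₁) :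
    ∃ (Y' : Scheme.{0}) (g : Y' ⟶ Y) (ψ : Y' ⟶ X₁), IsProper g ∧ IsIntegral Y' ∧
      Scheme.IsRegular Y' ∧ Function.Surjective g.base ∧
      (∃ V' : Y.Opens, Dense (V' : Set Y) ∧ IsFinite (g ∣_ V') ∧
        UniversallyInjective (g ∣_ V')) ∧
      ψ ≫ f₁ = g ≫ fY ∧ (g ⁻¹ᵁ V).ι ≫ ψ = (g ∣_ V) ≫ φ := by
  sorry

/-- STUB (OPEN from dimension 4): **`HypersurfacePialt` — the crux for integral hypersurfaces of
projective space over a perfect field.** For an integral closed subscheme `H ⊆ ℙⁿ⁺¹_k` of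
dimension `n` (a hypersurface: `ℙⁿ⁺¹` is factorial), there is a proper surjective `g : H' → H`
with `H'` integral regular, finite and universally injective over a dense open of `H`. The
embedded, codimension-one road to `PiRegModel`; genuinely a special case of the crux (the crux is
not known to be a birational invariant — that is exactly `stub_frobIndet`). -/
theorem stub_hypersurfacePialt (p : ℕ) (hp : p.Prime) (k : Type) [Field k] [CharP k p]
    [PerfectField k] (n : ℕ) (H : Scheme.{0}) (ι : H ⟶ (Literature.AlgebraicGeometry.Motives.projectiveSpace (n + 1) k).left)
    [IsClosedImmersion ι] [IsIntegral H] (hdim : topologicalKrullDim H = (n : WithBot ℕ∞)) :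
    ∃ (H' : Scheme.{0}) (g : H' ⟶ H), IsProper g ∧ IsIntegral H' ∧ Scheme.IsRegular H' ∧
      Function.Surjective g.base ∧ ∃ U : H.Opens, Dense (U : Set H) ∧ IsFinite (g ∣_ U) ∧
        UniversallyInjective (g ∣_ U) := by
  sorry

/-! ## The two pieces at one field, from the stubs -/

/-- `FrobIndet` over the field `k` (explicit-hypothesis form consumed by the glue). -/
def FrobIndetOver (k : Type) [Field k] : Prop :=
  ∀ (Y X₁ : Scheme.{0}) (fY : Y ⟶ Spec (.of k)) (f₁ : X₁ ⟶ Spec (.of k)), IsProper fY →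
    IsProper f₁ → IsIntegral Y → Scheme.IsRegular Y → IsIntegral X₁ →
    ∀ (V : Y.Opens) (φ : (V : Scheme.{0}) ⟶ X₁), (V : Set Y).Nonempty → V.ι ≫ fY = φ ≫ f₁ →
      ∃ (Y' : Scheme.{0}) (g : Y' ⟶ Y) (ψ : Y' ⟶ X₁), IsProper g ∧ IsIntegral Y' ∧
        Scheme.IsRegular Y' ∧ Function.Surjective g.base ∧
        (∃ V' : Y.Opens, Dense (V' : Set Y) ∧ IsFinite (g ∣_ V') ∧
          UniversallyInjective (g ∣_ V')) ∧
        ψ ≫ f₁ = g ≫ fY ∧ (g ⁻¹ᵁ V).ι ≫ ψ = (g ∣_ V) ≫ φ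

/-- `PiRegModel` over the field `k` (explicit-hypothesis form consumed by the glue). -/
def PiRegModelOver (k : Type) [Field k] : Prop :=
  ∀ (X : Scheme.{0}) (f : X ⟶ Spec (.of k)), IsProper f → IsIntegral X →
    ∃ (Y : Scheme.{0}) (h : Y ⟶ Spec (.of k)), IsProper h ∧ IsIntegral Y ∧ Scheme.IsRegular Y ∧
      ∃ (U : X.Opens) (V : Y.Opens) (ψ : (V : Scheme.{0}) ⟶ (U : Scheme.{0})),
        (U : Set X).Nonempty ∧ IsFinite ψ ∧ UniversallyInjective ψ ∧
          Function.Surjective ψ.base ∧ V.ι ≫ h = ψ ≫ U.ι ≫ f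

/-- `FrobIndetOver k` for perfect `k` of characteristic `p` IS `stub_frobIndet`. -/
theorem frobIndetOver_of_stub (p : ℕ) (hp : p.Prime) (k : Type) [Field k] [CharP k p]
    [PerfectField k] : FrobIndetOver k := by
  intro Y X₁ fY f₁ hfY hf₁ hY hYreg hX₁ V φ hV hφ
  haveI := hfY; haveI := hf₁; haveI := hY; haveI := hX₁
  exact stub_frobIndet p hp k Y X₁ fY f₁ hYreg V φ hV hφ

/-- `PiRegModelOver k` for perfect `k` of characteristic `p` from the hypersurface road:
hypersurface model (`stub_hypersurfaceModel`), the crux for that hypersurface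
(`stub_hypersurfacePialt`; `H` is proper over `k` as a closed subscheme of `ℙⁿ⁺¹_k`,
`isProper_projectiveSpace`), transfer across the birational identification
(`stub_piRegModel_of_birational`). -/
theorem piRegModelOver_of_stubs (p : ℕ) (hp : p.Prime) (k : Type) [Field k] [CharP k p]
    [PerfectField k] : PiRegModelOver k := by
  intro X f hf hX
  haveI := hf; haveI := hX
  obtain ⟨n, H, ι, hι, hH, hdim, U, W, e, he, hU, hcomm⟩ := stub_hypersurfaceModel k X f
  haveI := hι; haveI := hH; haveI := he
  haveI : IsProper (projectiveSpace (n + 1) k).hom := isProper_projectiveSpace (n + 1) k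
  haveI : IsProper (ι ≫ (projectiveSpace (n + 1) k).hom) := inferInstance
  have hPH := stub_hypersurfacePialt p hp k n H ι hdim
  exact stub_piRegModel_of_birational k X f H (ι ≫ (projectiveSpace (n + 1) k).hom) U W e hU
    (by simpa only [Category.assoc] using hcomm) hPH

/-! ## Glue (strategist's split theorem, evidence `PAlterationPialtSplit.lean`; sorry-free) -/

/-- **The split at a proper variety**: `FrobIndetOver k ∧ PiRegModelOver k ⇒` the crux
conclusion at every PROPER integral `X / k`. [folklore] -/
theorem pialtShape_proper_of_frobIndetOver_piRegModelOver (k : Type) [Field k]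
    (hI : FrobIndetOver k) (hM : PiRegModelOver k) (X : Scheme.{0}) (f : X ⟶ Spec (.of k))
    [IsProper f] [IsIntegral X] :
    ∃ (X' : Scheme.{0}) (g : X' ⟶ X), IsProper g ∧ IsIntegral X' ∧ Scheme.IsRegular X' ∧
      Function.Surjective g.base ∧ ∃ U : X.Opens, Dense (U : Set X) ∧ IsFinite (g ∣_ U) ∧
        UniversallyInjective (g ∣_ U) := by
  obtain ⟨Y, h, hh, hY, hYreg, U, V, ψ, hU, hfin, hui, hψs, hcomm⟩ :=
    hM X f inferInstance inferInstance
  haveI := hh; haveI := hY; haveI := hfin; haveI := hui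
  have hV : (V : Set Y).Nonempty := by
    obtain ⟨x, hx⟩ := hU
    obtain ⟨v, -⟩ := hψs ⟨x, hx⟩
    exact ⟨v.1, v.2⟩
  have hφ : V.ι ≫ h = (ψ ≫ U.ι) ≫ f := by
    rw [Category.assoc]
    exact hcomm
  obtain ⟨Y', g, ψ', hg, hY', hY'reg, hgs, ⟨V', hV', hfin', hui'⟩, hψ'f, hcompat⟩ :=
    hI Y X h f hh inferInstance hY hYreg inferInstance V (ψ ≫ U.ι) hV hφ
  haveI := hg; haveI := hY'; haveI := hfin'; haveI := hui'
  have hC := stub_image_ne_univ_of_isClosed k X f Y h U V ψ hU hψs hcomm Y' g hgs V' hV' ψ' hψ'f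
  exact stub_pialtShape_of_split_data k X f Y h U V ψ hU hψs hcomm Y' g hgs V' hV' ψ' hψ'f
    hY'reg hcompat hC

/-- **The split at an arbitrary variety over one field** (reduce to normal proper `X`:
`pialtConclusion_of_forall_normal_proper`). [folklore] -/
theorem pialtShape_of_frobIndetOver_piRegModelOver {k : Type} [Field k] (hI : FrobIndetOver k)
    (hM : PiRegModelOver k) (X : Scheme.{0}) (f : X ⟶ Spec (.of k)) [IsSeparated f]
    [LocallyOfFiniteType f] [QuasiCompact f] [IsIntegral X] :
    ∃ (X' : Scheme.{0}) (g : X' ⟶ X), IsProper g ∧ IsIntegral X' ∧ Scheme.IsRegular X' ∧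
      Function.Surjective g.base ∧ ∃ U : X.Opens, Dense (U : Set X) ∧ IsFinite (g ∣_ U) ∧
        UniversallyInjective (g ∣_ U) :=
  pialtConclusion_of_forall_normal_proper f fun X' f' hf' hi' _ => by
    haveI := hf'; haveI := hi'
    exact pialtShape_proper_of_frobIndetOver_piRegModelOver k hI hM X' f'

/-! ## Composition -/

/-- COMPOSITION: the crux BY NAME from the four stubs (perfect fields suffice:
`PalterationThesis.PerfectTransfer.stub_pialtOfPerfect`). Sorries only inside `stub_*`. -/
theorem Pialt_of : Pialt := by
  intro p hp k _ _ X f hs hl hq hi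
  haveI : Fact p.Prime := ⟨hp⟩
  haveI := hs; haveI := hl; haveI := hq; haveI := hi
  exact PalterationThesis.PerfectTransfer.stub_pialtOfPerfect p k
    (fun Y g hs' hl' hq' hi' => by
      haveI := hs'; haveI := hl'; haveI := hq'; haveI := hi'
      exact pialtShape_of_frobIndetOver_piRegModelOver
        (frobIndetOver_of_stub p hp (PerfectClosure k p))
        (piRegModelOver_of_stubs p hp (PerfectClosure k p)) Y g)
    X f

end Summit.ResolutionOfSingularities.ResolutionOfSingularities.Theorems.Pialt.IndeterminacySplit

end
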